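import Literature.MathematicalPhysics.QuantumFieldTheory.Balaban1983to89.B15Prop1GaugeLetterGammaZeroPin
import Literature.MathematicalPhysics.QuantumFieldTheory.Balaban1983to89.B15Prop1NumericsThresholds
import Literature.MathematicalPhysics.QuantumFieldTheory.Balaban1983to89.B15Prop1Carrier

/-!
# `Balaban1983to89.B15Prop1GaugeLetterTargetOfLinearBudgets` — [Balaban1989LargeFieldI] Prop. 1 p. 194 («for ε > 0 sufficiently small»); [Balaban1985Variational] (4) p. 278,
# (16)–(18) p. 280; [Balaban1988Convergent] (2.2) p. 255, (2.11)–(2.13) pp. 256–257: ★ THE LOCALISED GAUGE LETTER (σ)_N AT A TARGET TOLERANCE FROM A PRODUCER WITH TOLERANCES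
# LINEAR IN THE GUARD — the ∀δ∃e socket of the assembled N12 endpoints, inhabited by one token

Honest framing: statement-level skeleton of published theorems with citation tags; proofs where landed; nothing here is a claim about the Yang–Mills mass gap.

Cell `pub-ymgap`, HUMAN RULINGS D-0062 ∕ D-0149 ∕ D-0154, width seat `pub-ymgap-dag-n12-w5` (g5) on node N12 = [B15]; count-neutral helper of K1⁹ `stmt-QuantumFields-27364`.  The lane
owner dag-n12-c g19's word (pub-ymgap INBOX 2026-08-28T14:10:33Z, ASK-5 answer «(o6a) GO»).

WHY.  The assembled N12 endpoints of this lineage (`BalabanUVNodesN12Prop1AssembledOfGaugeLetterAtToleranceLoc` p637658, `…LocOfChartLetterN` p639701) ask the localised gauge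
letter (σ)_N in the ∀δ∃e FORM: per instance, for every target tolerance `δ > 0` a guard `e > 0` such that at every base field of the guard `e` whose extended datum is within
`ρlin·e` of `1` on the region box (`ρlin` = the `hρn` coefficient of the endpoints, spelled), every (2.12) minimiser `U₀` has a residual gauge `σ` with the root letter, `σ • U₀`
`δ`-near `1` on the `Ω₁(Z)`-plaquette bonds (C1) and on `inputs 𝐁_k(Z) ∩ N` (Cin_N).  The PRODUCER side (dag-n12-w6 g2: `B15Prop1GaugeLetterGammaZeroPin` §4–§5 and the assembled
`B15Prop1GaugeLetterLocOfForestPackage.exists_gaugeLetterLoc_atRecord_of_forestPackage` ∘ `tolerance_le_of_target`) delivers, at every guard `e` below a reference guard `e₀`, the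
same letter with a tolerance LINEAR in `e` (datum `ρlin·e`, the [15]-door plaquette budget `εP ≤ cP·e`, the transporter ∕ gauge budgets `eT, dG ≤ c·e`).  THIS FILE is the
one-token junction: linear tolerances below `e₀` ⟹ the ∀δ∃e socket, with the guard chosen by dag-n12-c g19's `B15Prop1NumericsThresholds.exists_eR_of_linear_moduli` (p633310 §4;
not re-proved).  Stated in the single-instance spelling ON THE SOCKET's TEXT (`k Z Λ ext LO HI n n' N`), so the knit writes `hσN := fun i => forall_target_exists_guard_of_linear … (hlin i)`.

WHAT THIS FILE PROVES (no `sorry`, no definition; axioms standard).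
§1 ★ `forall_target_exists_guard_of_linear` — ONE linear modulus `Cσ` for both clauses.  §1 ★ `forall_target_exists_guard_of_linear₂` — two moduli (`Cσ` for C1, `Cin` for Cin_N).

HONEST SCOPE.  Pure bookkeeping (real arithmetic + one `obtain`); the gauge letter itself ([15] (16)–(18) in dag-n12-w6's tower-axial gauge, the forest, the root transporter, the [15]
Theorem-1 door) stays a HYPOTHESIS; nothing of Bałaban's is asserted; count-neutral; NOT a discharge of N12; K1 NOT closed; one finite four-torus programme at fixed `ε = L^{-K}` —
nothing continuum ∕ ℝ⁴ ∕ OS ∕ mass-gap ∕ Clay.  No `def`, no `instance`, no `sorry`.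

## References
* [Balaban1989LargeFieldI] T. Bałaban, Commun. Math. Phys. 122 (1989) 175–202, (1.74) p. 192, Prop. 1 (1.77)–(1.78) p. 194.
* [Balaban1985Variational] T. Bałaban, Commun. Math. Phys. 102 (1985) 277–309, (4) p. 278, Thm 1 (8) p. 279, (16)–(18) p. 280.
* [Balaban1988Convergent] T. Bałaban, Commun. Math. Phys. 119 (1988) 243–285, (2.2) p. 255, (2.11)–(2.13) pp. 256–257, (2.16) p. 257.
-/

noncomputable section

open Set
open scoped Matrix.Norms.L2Operator

namespace Literature.MathematicalPhysics.QuantumFieldTheory.Balaban1983to89.B15Prop1GaugeLetterTargetOfLinearBudgets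

open T4Continuum B15DeterminingSets GaugeField
open B15Prop1Carrier (plaqsInside)
open T4CubeChartGnomonic (SU2)
open B16Sect1Backgrounds (toMS)
open B14.Eq213DetSet (Bj maxDomT)
open B14.Eq216Concrete (inputs)
open T4AxialGaugeSmallField (boxBonds)
open B15Prop1NumericsThresholds (exists_eR_of_linear_moduli)
open Literature.MathematicalPhysics.QuantumFieldTheory.BalabanImbrieJaffe1984to88.BIJ85Eq453GaugeField (qsstarGIter0)

variable {F : T4Family}

/-! ## §1  Linear tolerances below a reference guard ⟹ every target tolerance below some guard -/

/-- ★ **THE ∀δ∃e SOCKET OF THE ASSEMBLED N12 ENDPOINTS FROM A LINEAR PRODUCER.**  Objects of one Prop-1 instance at print's (1.74) object, in the socket's spelling: averaging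
`Node00.avOfRecord F 2 Kt`, class `regMSCoPOfRecord F 2 ν Kt k (maxDomT ν.M₁ Z)`, determining set `𝐁_k(Z) = Bj ν.M₁ Z k`, the base fields' extension `ext`, the region box
`boxBonds LO HI` with the datum tolerance `ρlin·e` spelled as the endpoints' `hρn` expression in the box sizes `n n'`, the neighbourhood `N`.  HYPOTHESIS `hlin`: at every guard
`0 < e ≤ e₀` the localised gauge letter holds with the single tolerance `Cσ·e` (`0 ≤ Cσ`).  CONCLUSION: the `hσN` row of `…AssembledOfGaugeLetterAtToleranceLoc(OfChartLetterN)` for this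
instance, VERBATIM.  Proof: `e := ` dag-n12-c g19's `exists_eR_of_linear_moduli`, then `·.trans`.
[cite: Balaban1989LargeFieldI, Prop. 1 p.194 («for ε > 0 sufficiently small»); Balaban1985Variational, (4) p.278, (16)–(18) p.280; Balaban1988Convergent, (2.2) p.255, (2.11)–(2.13) pp.256–257] -/
theorem forall_target_exists_guard_of_linear (ν : Node00.Stage7Numerics) (Kt : ℕ) {k : ℕ}
    (Z Λ : Set (Site (F.P Kt) 0)) (ext : GaugeField (F.P Kt) k SU2 → GaugeField (F.P Kt) k SU2)
    (LO HI : Fin (F.P Kt).d → ℤ) (n n' : ℕ) (N : Set (PBond (F.P Kt) 0))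
    {e₀ Cσ : ℝ} (he₀ : 0 < e₀) (hCσ : 0 ≤ Cσ)
    -- the PRODUCER: at every guard `e ∈ (0, e₀]`, the localised letter with tolerance `Cσ·e`
    (hlin : ∀ e : ℝ, 0 < e → e ≤ e₀ → ∀ (Vk : GaugeField (F.P Kt) k SU2), PlaqSmallOn (plaqsInside (pts k (Z ∩ Λᶜ))) e Vk →
      (∀ b ∈ (boxBonds LO HI : Set (PBond (F.P Kt) k)), dist1 (ext Vk b) ≤
        (((F.P Kt).d : ℝ) * n' + 1) * ((((F.P Kt).d - 1 : ℕ) : ℝ) * n' * ((12 * (F.P Kt).d * (n + 2) ^ 2 + 1) * e) + 3 * (F.P Kt).d * (n + 2) ^ 2 * e)) →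
      ∀ U₀ : GaugeField (F.P Kt) 0 SU2,
        IsMinimizer (Node00.avOfRecord F 2 Kt) (Node00.regMSCoPOfRecord F 2 ν Kt k (maxDomT ν.M₁ Z)) (Bj ν.M₁ Z k)
          (avgFamily (Node00.avOfRecord F 2 Kt) (qsstarGIter0 k (ext Vk))) U₀ →
        ∃ σ : GaugeTransf (F.P Kt) 0 SU2,
          (∀ j, j ≤ k → ∀ b ∈ bondsOf (Bj ν.M₁ Z k j), toMS σ j b.src = 1 ∧ toMS σ j b.tgt = 1) ∧
            (∀ p : Plaq (F.P Kt) 0, ((⟨p.src, p.μ⟩ : PBond (F.P Kt) 0) ∈ {b : PBond (F.P Kt) 0 | b.src ∈ maxDomT ν.M₁ Z 1} ∨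
                (⟨p.src.shift p.μ, p.ν⟩ : PBond (F.P Kt) 0) ∈ {b : PBond (F.P Kt) 0 | b.src ∈ maxDomT ν.M₁ Z 1} ∨
                (⟨p.src.shift p.ν, p.μ⟩ : PBond (F.P Kt) 0) ∈ {b : PBond (F.P Kt) 0 | b.src ∈ maxDomT ν.M₁ Z 1} ∨
                (⟨p.src, p.ν⟩ : PBond (F.P Kt) 0) ∈ {b : PBond (F.P Kt) 0 | b.src ∈ maxDomT ν.M₁ Z 1}) →
              ‖((gaugeAct σ U₀ ⟨p.src, p.μ⟩ : SU2) : Matrix (Fin 2) (Fin 2) ℂ) - 1‖ ≤ Cσ * e ∧ ‖((gaugeAct σ U₀ ⟨p.src.shift p.μ, p.ν⟩ : SU2) : Matrix (Fin 2) (Fin 2) ℂ) - 1‖ ≤ Cσ * e ∧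
                ‖((gaugeAct σ U₀ ⟨p.src.shift p.ν, p.μ⟩ : SU2) : Matrix (Fin 2) (Fin 2) ℂ) - 1‖ ≤ Cσ * e ∧ ‖((gaugeAct σ U₀ ⟨p.src, p.ν⟩ : SU2) : Matrix (Fin 2) (Fin 2) ℂ) - 1‖ ≤ Cσ * e) ∧
          (∀ b ∈ inputs (Bj ν.M₁ Z k), b ∈ N → ‖((gaugeAct σ U₀ b : SU2) : Matrix (Fin 2) (Fin 2) ℂ) - 1‖ ≤ Cσ * e)) :
    ∀ δ : ℝ, 0 < δ → ∃ e : ℝ, 0 < e ∧ ∀ (Vk : GaugeField (F.P Kt) k SU2), PlaqSmallOn (plaqsInside (pts k (Z ∩ Λᶜ))) e Vk →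
      (∀ b ∈ (boxBonds LO HI : Set (PBond (F.P Kt) k)), dist1 (ext Vk b) ≤
        (((F.P Kt).d : ℝ) * n' + 1) * ((((F.P Kt).d - 1 : ℕ) : ℝ) * n' * ((12 * (F.P Kt).d * (n + 2) ^ 2 + 1) * e) + 3 * (F.P Kt).d * (n + 2) ^ 2 * e)) →
      ∀ U₀ : GaugeField (F.P Kt) 0 SU2,
        IsMinimizer (Node00.avOfRecord F 2 Kt) (Node00.regMSCoPOfRecord F 2 ν Kt k (maxDomT ν.M₁ Z)) (Bj ν.M₁ Z k)
          (avgFamily (Node00.avOfRecord F 2 Kt) (qsstarGIter0 k (ext Vk))) U₀ →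
        ∃ σ : GaugeTransf (F.P Kt) 0 SU2,
          (∀ j, j ≤ k → ∀ b ∈ bondsOf (Bj ν.M₁ Z k j), toMS σ j b.src = 1 ∧ toMS σ j b.tgt = 1) ∧
            (∀ p : Plaq (F.P Kt) 0, ((⟨p.src, p.μ⟩ : PBond (F.P Kt) 0) ∈ {b : PBond (F.P Kt) 0 | b.src ∈ maxDomT ν.M₁ Z 1} ∨
                (⟨p.src.shift p.μ, p.ν⟩ : PBond (F.P Kt) 0) ∈ {b : PBond (F.P Kt) 0 | b.src ∈ maxDomT ν.M₁ Z 1} ∨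
                (⟨p.src.shift p.ν, p.μ⟩ : PBond (F.P Kt) 0) ∈ {b : PBond (F.P Kt) 0 | b.src ∈ maxDomT ν.M₁ Z 1} ∨
                (⟨p.src, p.ν⟩ : PBond (F.P Kt) 0) ∈ {b : PBond (F.P Kt) 0 | b.src ∈ maxDomT ν.M₁ Z 1}) →
              ‖((gaugeAct σ U₀ ⟨p.src, p.μ⟩ : SU2) : Matrix (Fin 2) (Fin 2) ℂ) - 1‖ ≤ δ ∧ ‖((gaugeAct σ U₀ ⟨p.src.shift p.μ, p.ν⟩ : SU2) : Matrix (Fin 2) (Fin 2) ℂ) - 1‖ ≤ δ ∧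
                ‖((gaugeAct σ U₀ ⟨p.src.shift p.ν, p.μ⟩ : SU2) : Matrix (Fin 2) (Fin 2) ℂ) - 1‖ ≤ δ ∧ ‖((gaugeAct σ U₀ ⟨p.src, p.ν⟩ : SU2) : Matrix (Fin 2) (Fin 2) ℂ) - 1‖ ≤ δ) ∧
          (∀ b ∈ inputs (Bj ν.M₁ Z k), b ∈ N → ‖((gaugeAct σ U₀ b : SU2) : Matrix (Fin 2) (Fin 2) ℂ) - 1‖ ≤ δ) := by
  intro δ hδ
  -- the guard: dag-n12-c g19's step (4), `e := min e₀ (δ ∕ (Cσ + 1))`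
  obtain ⟨e, he, hee₀, hle, -, -⟩ := exists_eR_of_linear_moduli he₀ hδ hCσ hCσ
  refine ⟨e, he, fun Vk hV hD U₀ hU₀ => ?_⟩
  obtain ⟨σ, hu, hC1, hCin⟩ := hlin e he hee₀ Vk hV hD U₀ hU₀
  refine ⟨σ, hu, fun p hp => ?_, fun b hb hbN => (hCin b hb hbN).trans hle⟩
  obtain ⟨h₁, h₂, h₃, h₄⟩ := hC1 p hp
  exact ⟨h₁.trans hle, h₂.trans hle, h₃.trans hle, h₄.trans hle⟩

/-- ★ **THE SAME WITH TWO LINEAR MODULI** (`Cσ` for the `Ω₁`-plaquette clause C1, `Cin` for the localised `inputs` clause): the ∀δ∃e socket with ONE target tolerance for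
both, guard `e := min e₀ (δ ∕ (max Cσ Cin + 1))` (`exists_eR_of_linear_moduli`).
[cite: Balaban1989LargeFieldI, Prop. 1 p.194 («for ε > 0 sufficiently small»); Balaban1985Variational, (4) p.278, (16)–(18) p.280; Balaban1988Convergent, (2.2) p.255, (2.11)–(2.13) pp.256–257] -/
theorem forall_target_exists_guard_of_linear₂ (ν : Node00.Stage7Numerics) (Kt : ℕ) {k : ℕ}
    (Z Λ : Set (Site (F.P Kt) 0)) (ext : GaugeField (F.P Kt) k SU2 → GaugeField (F.P Kt) k SU2)
    (LO HI : Fin (F.P Kt).d → ℤ) (n n' : ℕ) (N : Set (PBond (F.P Kt) 0))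
    {e₀ Cσ Cin : ℝ} (he₀ : 0 < e₀) (hCσ : 0 ≤ Cσ) (hCin : 0 ≤ Cin)
    (hlin : ∀ e : ℝ, 0 < e → e ≤ e₀ → ∀ (Vk : GaugeField (F.P Kt) k SU2), PlaqSmallOn (plaqsInside (pts k (Z ∩ Λᶜ))) e Vk →
      (∀ b ∈ (boxBonds LO HI : Set (PBond (F.P Kt) k)), dist1 (ext Vk b) ≤
        (((F.P Kt).d : ℝ) * n' + 1) * ((((F.P Kt).d - 1 : ℕ) : ℝ) * n' * ((12 * (F.P Kt).d * (n + 2) ^ 2 + 1) * e) + 3 * (F.P Kt).d * (n + 2) ^ 2 * e)) →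
      ∀ U₀ : GaugeField (F.P Kt) 0 SU2,
        IsMinimizer (Node00.avOfRecord F 2 Kt) (Node00.regMSCoPOfRecord F 2 ν Kt k (maxDomT ν.M₁ Z)) (Bj ν.M₁ Z k)
          (avgFamily (Node00.avOfRecord F 2 Kt) (qsstarGIter0 k (ext Vk))) U₀ →
        ∃ σ : GaugeTransf (F.P Kt) 0 SU2,
          (∀ j, j ≤ k → ∀ b ∈ bondsOf (Bj ν.M₁ Z k j), toMS σ j b.src = 1 ∧ toMS σ j b.tgt = 1) ∧
            (∀ p : Plaq (F.P Kt) 0, ((⟨p.src, p.μ⟩ : PBond (F.P Kt) 0) ∈ {b : PBond (F.P Kt) 0 | b.src ∈ maxDomT ν.M₁ Z 1} ∨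
                (⟨p.src.shift p.μ, p.ν⟩ : PBond (F.P Kt) 0) ∈ {b : PBond (F.P Kt) 0 | b.src ∈ maxDomT ν.M₁ Z 1} ∨
                (⟨p.src.shift p.ν, p.μ⟩ : PBond (F.P Kt) 0) ∈ {b : PBond (F.P Kt) 0 | b.src ∈ maxDomT ν.M₁ Z 1} ∨
                (⟨p.src, p.ν⟩ : PBond (F.P Kt) 0) ∈ {b : PBond (F.P Kt) 0 | b.src ∈ maxDomT ν.M₁ Z 1}) →
              ‖((gaugeAct σ U₀ ⟨p.src, p.μ⟩ : SU2) : Matrix (Fin 2) (Fin 2) ℂ) - 1‖ ≤ Cσ * e ∧ ‖((gaugeAct σ U₀ ⟨p.src.shift p.μ, p.ν⟩ : SU2) : Matrix (Fin 2) (Fin 2) ℂ) - 1‖ ≤ Cσ * e ∧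
                ‖((gaugeAct σ U₀ ⟨p.src.shift p.ν, p.μ⟩ : SU2) : Matrix (Fin 2) (Fin 2) ℂ) - 1‖ ≤ Cσ * e ∧ ‖((gaugeAct σ U₀ ⟨p.src, p.ν⟩ : SU2) : Matrix (Fin 2) (Fin 2) ℂ) - 1‖ ≤ Cσ * e) ∧
          (∀ b ∈ inputs (Bj ν.M₁ Z k), b ∈ N → ‖((gaugeAct σ U₀ b : SU2) : Matrix (Fin 2) (Fin 2) ℂ) - 1‖ ≤ Cin * e)) :
    ∀ δ : ℝ, 0 < δ → ∃ e : ℝ, 0 < e ∧ ∀ (Vk : GaugeField (F.P Kt) k SU2), PlaqSmallOn (plaqsInside (pts k (Z ∩ Λᶜ))) e Vk →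
      (∀ b ∈ (boxBonds LO HI : Set (PBond (F.P Kt) k)), dist1 (ext Vk b) ≤
        (((F.P Kt).d : ℝ) * n' + 1) * ((((F.P Kt).d - 1 : ℕ) : ℝ) * n' * ((12 * (F.P Kt).d * (n + 2) ^ 2 + 1) * e) + 3 * (F.P Kt).d * (n + 2) ^ 2 * e)) →
      ∀ U₀ : GaugeField (F.P Kt) 0 SU2,
        IsMinimizer (Node00.avOfRecord F 2 Kt) (Node00.regMSCoPOfRecord F 2 ν Kt k (maxDomT ν.M₁ Z)) (Bj ν.M₁ Z k)
          (avgFamily (Node00.avOfRecord F 2 Kt) (qsstarGIter0 k (ext Vk))) U₀ →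
        ∃ σ : GaugeTransf (F.P Kt) 0 SU2,
          (∀ j, j ≤ k → ∀ b ∈ bondsOf (Bj ν.M₁ Z k j), toMS σ j b.src = 1 ∧ toMS σ j b.tgt = 1) ∧
            (∀ p : Plaq (F.P Kt) 0, ((⟨p.src, p.μ⟩ : PBond (F.P Kt) 0) ∈ {b : PBond (F.P Kt) 0 | b.src ∈ maxDomT ν.M₁ Z 1} ∨
                (⟨p.src.shift p.μ, p.ν⟩ : PBond (F.P Kt) 0) ∈ {b : PBond (F.P Kt) 0 | b.src ∈ maxDomT ν.M₁ Z 1} ∨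
                (⟨p.src.shift p.ν, p.μ⟩ : PBond (F.P Kt) 0) ∈ {b : PBond (F.P Kt) 0 | b.src ∈ maxDomT ν.M₁ Z 1} ∨
                (⟨p.src, p.ν⟩ : PBond (F.P Kt) 0) ∈ {b : PBond (F.P Kt) 0 | b.src ∈ maxDomT ν.M₁ Z 1}) →
              ‖((gaugeAct σ U₀ ⟨p.src, p.μ⟩ : SU2) : Matrix (Fin 2) (Fin 2) ℂ) - 1‖ ≤ δ ∧ ‖((gaugeAct σ U₀ ⟨p.src.shift p.μ, p.ν⟩ : SU2) : Matrix (Fin 2) (Fin 2) ℂ) - 1‖ ≤ δ ∧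
                ‖((gaugeAct σ U₀ ⟨p.src.shift p.ν, p.μ⟩ : SU2) : Matrix (Fin 2) (Fin 2) ℂ) - 1‖ ≤ δ ∧ ‖((gaugeAct σ U₀ ⟨p.src, p.ν⟩ : SU2) : Matrix (Fin 2) (Fin 2) ℂ) - 1‖ ≤ δ) ∧
          (∀ b ∈ inputs (Bj ν.M₁ Z k), b ∈ N → ‖((gaugeAct σ U₀ b : SU2) : Matrix (Fin 2) (Fin 2) ℂ) - 1‖ ≤ δ) := by
  intro δ hδ
  obtain ⟨e, he, hee₀, hle, hle', -⟩ := exists_eR_of_linear_moduli he₀ hδ hCσ hCin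
  refine ⟨e, he, fun Vk hV hD U₀ hU₀ => ?_⟩
  obtain ⟨σ, hu, hC1, hCin'⟩ := hlin e he hee₀ Vk hV hD U₀ hU₀
  refine ⟨σ, hu, fun p hp => ?_, fun b hb hbN => (hCin' b hb hbN).trans hle'⟩
  obtain ⟨h₁, h₂, h₃, h₄⟩ := hC1 p hp
  exact ⟨h₁.trans hle, h₂.trans hle, h₃.trans hle, h₄.trans hle⟩

end Literature.MathematicalPhysics.QuantumFieldTheory.Balaban1983to89.B15Prop1GaugeLetterTargetOfLinearBudgets

end
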